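import Literature.NumberTheory.EllipticCurves.HeegnerPointsKolyvaginStructure
import Literature.NumberTheory.EllipticCurves.BSDHeegnerPoints
import Literature.NumberTheory.EllipticCurves.BSDRootNumberSmallConductorProofs
import HarnessLib
import HarnessLib.Audit.Tags

/-!
# O5 / O6 — the REFINED KOLYVAGIN CONJECTURE AT AN ADDITIVE `3` (cell `b2b-bsdres`, team o5o6,
# seat O6-planner-2 "non-Iwasawa side"; a TARGET FORMULATION — `def … : Prop` only, NOTHING asserted)

HONEST FRAMING (cell `b2b-bsdres`, run/shared/lean/b2b/bsd-rank1-residual/, verbatim in every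
file): the goal of the cell is to DELETE the COMBINATION-SHAPED residual classes of the
Birch–Swinnerton-Dyer formula for ALL analytic-rank `≤ 1` elliptic curves over `ℚ` — "full BSD
formula for every rank `≤ 1` curve in class `C`" assembled STRICTLY from published theorems — so
that the rank-`≤ 1` remainder becomes exactly the CONSTRUCTION-SHAPED classes, which are TYPED
(missing-input `Prop`s), NOT attempted. This is not "finishing BSD". Teams O5 / O6 (additive,
potentially good SUPERSINGULAR reduction at `p = 3`; O5 tame `v₃(N) = 2`, O6 wild `v₃(N) ≥ 3`;
RESIDUAL-MAP §D: "OPEN — no `p`-adic `L` / main conjecture even FORMULATED"): FORMULATE A TARGET.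
Research routes; no claim beyond stated classes; census output = EVIDENCE / conjecture items, never
a Literature fact. NOTHING below is asserted — `def … : Prop` only; the two `theorem`s are
one-line unfoldings.

## What this file types

The Heegner-point / Kolyvagin side at `p = 3 ∣ N` needs NO `p`-adic `L`-function and NO condition
on the reduction type at `p`: Kolyvagin's system `{c_M(n)}` (tree: `KolyvaginHeegnerData.kolyvaginClass`,
Zhang's Kolyvagin primes `ℓ ∤ N d_K p` and levels `M ≤ M(n)`, file `HeegnerPointsOfConductor`) is
built for EVERY modular `E/ℚ` and every prime `p`, and Kolyvagin's STRUCTURE THEOREM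
(Kolyvagin 1991, *Euler systems*/*On the structure of Sha*; McCallum 1991 Thm. 5.4 + 5.8;
Zhang 2014 Thm. 10.2 + Remark 18 with `ν = 0`) reads, for `y_K` non-torsion, `p` odd,
`ρ_{E,p^∞}` onto and `E(K)[p] = 0`:  `#Ш(E/K)[p^∞] = p^{2(M₀ − M_∞)}`, `M₀ = ord_p [E(K) : ℤ y_K]`,
`M_∞ = min_n 𝓜(n)` the eventual `p`-divisibility of the derived classes. Hence the `p`-part of
BSD for `E/K` (Gross–Zagier form, Gross 1991 (2.4): `#Ш(E/K) = ([E(K):ℤy_K] / (c·∏_{q∣N} c_q))²`)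
is EQUIVALENT to the single divisibility statement

  (RKC)  `M_∞(E, K, p) = ord_p (c · ∏_{q ∣ N} c_q(E))`

— Jetchev 2008 Conj. 1.3 (stated under `p ∤ N`, `ρ̄` onto), Zhang 2014 Thm. 1.1 / BCGS 2026 Thm. 2
("refined Kolyvagin conjecture": PROVED for `p ∤ N` good ordinary, `p > 3` resp. `p ≥ 5` + hypotheses),
W. Zhang's `𝓜`-notation §3.8. At an ADDITIVE `p = 3` it has never been stated in print (searches in
TARGETS.md §O6-T1 "Novelty"); this file states it, split into its two halves, in the tree's vocabulary:

* `ClassDivisibleBy d M m`      — `c_M(n) ∈ 3^m · H¹(K, E[3^M])`;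
* `MinftyGe W K Dt β ι m`      — `M_∞ ≥ m`: every class at every Kolyvagin level is `3^m`-divisible;
* `MinftyEq W K Dt β ι m`      — `M_∞ = m`;
* `RKC3Divisibility`  (T1⁺, "Jetchev direction", `M_∞ ≥ t`)  — FINITELY FALSIFIABLE per pair;
* `RKC3Indivisibility` (T1⁻, "Zhang/BCGS direction", `M_∞ ≤ t`) — per pair CERTIFIABLE by ONE class;
* `RefinedKolyvaginAdditiveThree` (T1 = T1⁺ ∧ T1⁻), scope: `9 ∣ N_E` (additive at `3`: O5 ∪ O6 ∪ the
  potentially multiplicative additive rows), `ρ_{E,3^∞}` onto (tower binder, as in the cell's N11 files —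
  Elkies' `9`-deficient curves make "surj(3) ⇒ 3-adic onto" FALSE), `K` Heegner for `N_E` with
  `d_K ≠ −3, −4`, `ord_{s=1} L(E/K,s) = 1`, a parametrisation datum with `3 ∤ c(Dt)` (the kernel's `hc`;
  for `E[3]` irreducible every isogeny in the class has degree prime to `3`, so this is "`3 ∤` Manin
  constant of the optimal curve", Cremona-table data), `t = ord₃ ∏_q c_q(E)` (`W.tamagawaProduct`,
  INCLUDING `q = 3`: `c₃ = 3` exactly at Kodaira types IV, IV*).
* `KolyvaginStructureThreeShape` — the SHAPE in which the published structure theorem is to be cited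
  (a Literature named fact for the typers; hypotheses as printed: NO `p ∤ N` — Gross 1991 Prop. 6.2(1)
  p. 222 treats `v ∣ N` incl. `v ∣ p`; McCallum 1991 §5 assumes only `p` odd, (H1) `ρ̄` "large", (H2)
  `y_K` non-torsion; referee to confirm the `p ∣ N` reading line by line — flagged, not assumed).
* `rkc3_reduction_shape` — bookkeeping: Structure ∧ T1 at `(E,K)` ⇒ the Heegner INDEX IDENTITY over `K`
  `2 t + ord₃ #Ш(E/K) = 2 ord₃ [E(K):ℤP]` (literally `X11b.IndexIdentityAt W 3 K P` of the cell), which the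
  kernel's odd-`p` descent `X11b.bsdp_of_indexIdentityAt` (hypothesis `p ≠ 2` only) turns into `BSDp W 3`
  GIVEN the rank-`0` `3`-part of the twist `E^{d_K}` — at a wild `3` that twist is again wild (every
  quadratic twist of a wild pot-good curve is), rank `0`, and is N11's job (Kato–Kim–Sakamoto side). So T1
  is EXACTLY the Heegner-side input that, with N11(r=0), closes the rank-ONE rows of O5/O6 ∩ X4 ∩ towerSurj(3).

Antecedents (EVIDENCE labels; page numbers = PDF pages of the materialised texts):
[corpus:book:editornd-l-functions-arithmetic p0213 (Gross 1991 Conj. (1.2)(2), (2.4)), p0222 (Prop. 6.2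
proof at v ∣ N), p0279/p0284 (McCallum hypotheses), p0288 (Thm. 5.4), p0290 (Thm. 5.8)];
[corpus:paper:doi-10-4310-cjm-2014-v2-n2-a2 p0004, p0023–p0024 (§3.8 𝓜(n), M_∞, Conj. 3.2), p0054–p0056
(Lemma 10.1, Thm. 10.2, Remark 18)]; [corpus:paper:arxiv-math_0703431 p0003 (Jetchev Conj. 1.1, (∗), (1),
Conj. 1.3, Thm. 1.4), p0015 (Remark 6.2)]; [corpus:paper:arxiv-2312.09301 p0003–p0005 (BCGS Thm. 1, Thm. 2,
`p`-optimal π)]; [corpus:paper:arxiv-0707.0032 p0008–p0009 (JLS 2009 Prop. 3.10, Prop. 4.2: the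
computational instrument)]; galaxy: no hits for "refined Kolyvagin|Kolyvagin conjecture additive|M_infty
Tamagawa" (star all).
-/

namespace Summit.BirchSwinnertonDyer.Rank1Residual.AdditiveThree

open scoped Classical
open Literature.NumberTheory.EllipticCurves Literature.NumberTheory.EllipticCurves.ModularForms
  WeierstrassCurve

universe u

/-! ## §1. The divisibility index `M_∞` of the Heegner-point Kolyvagin system at `p = 3` -/

section Minfty

variable {N : ℕ} [NeZero N] {W : WeierstrassCurve ℚ} {K : Type} [Field K] [NumberField K]
  {Dt : ModularParametrizationData W N} {β : ℤ} {ι : K →+* ℂ} {n : ℕ}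

/-- `c_M(n) ∈ 3^m · H¹(K, E[3^M])`: the Kolyvagin class of the datum `d` at level `3^M` is
`3^m`-divisible in the (additive, abelian) group `H¹(K, E[3^M])` (tree `galH1Torsion`). Zhang 2014
§3.8: "`𝓜(n) = max {𝓜 : c_M(n) ∈ p^𝓜 H¹(K, A_{g,M}) ∀ M ≤ M(n)}`". The junk value `0` of
`kolyvaginClass` (inadmissible data) is divisible by everything, so only GENUINE classes can witness
a failure of divisibility. A predicate; nothing asserted. [cite: WZhang2014, §3.8 (p. 213)] -/
def ClassDivisibleBy (d : KolyvaginHeegnerData Dt β ι n) (M m : ℕ) : Prop :=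
  ∃ x : galH1Torsion (W.baseChange K) ((3 ^ M : ℕ) : ℤ), d.kolyvaginClass Nat.prime_three M = (3 ^ m) • x

end Minfty

section MinftyGlobal

variable (W : WeierstrassCurve ℚ) [W.IsGloballyMinimal] (K : Type) [Field K] [NumberField K]
  [NeZero (W.conductorNorm ℤ)]
  (Dt : ModularParametrizationData W (W.conductorNorm ℤ)) (β : ℤ) (ι : K →+* ℂ)

/-- **`M_∞(E, K, 3) ≥ m`**: for every square-free product `n` of Kolyvagin primes (Zhang: `ℓ` prime to
`N d_K · 3`, inert, `M(ℓ) = min(ord₃(ℓ+1), ord₃ a_ℓ) > 0`; `n = 1` allowed, giving `c_M(1)` = the Kummer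
class of `y_K`, so `𝓜(1) = M₀`), every Kolyvagin datum `d` at `n` (CM-rationality data for `y(n)`, the
generators `σ_ℓ`, coset representatives), and every level `1 ≤ M ≤ M(n)`, the class `c_M(n)` is
`3^m`-divisible. `M_∞ = min_n 𝓜(n)` (Kolyvagin; Zhang 2014 §3.8; Jetchev 2008 §1 `m_∞`). A predicate.
[cite: WZhang2014, §3.8 (p. 213)] [cite: Jetchev2008, §1 (1)] -/
def MinftyGe (m : ℕ) : Prop :=
  ∀ (n : ℕ) (d : KolyvaginHeegnerData Dt β ι n) (M : ℕ),
    KolyvaginDescent.KolSupp (Zhang2014.IsKolyvaginPrime (W.conductorNorm ℤ) W K 3) n →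
    1 ≤ M → (M : ℕ∞) ≤ Zhang2014.levelIndex W 3 n → ClassDivisibleBy d M m

/-- **`M_∞(E, K, 3) = m`**: every class is `3^m`-divisible and SOME genuine class `c_M(n)` (some
Kolyvagin level `n`, some `M ≤ M(n)`) is not `3^{m+1}`-divisible. (The existential half also asserts that
Kolyvagin data EXIST at that `n` — CM theory, Gross 1991 §3 / `KolyvaginHeegnerData` docstring — a
theorem, carried as data in the tree.) A predicate. [cite: WZhang2014, §3.8 (p. 213)] -/
def MinftyEq (m : ℕ) : Prop :=
  MinftyGe W K Dt β ι m ∧ ¬ MinftyGe W K Dt β ι (m + 1)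

/-- Unfolding. [folklore] -/
theorem minftyEq_iff (m : ℕ) :
    MinftyEq W K Dt β ι m ↔ MinftyGe W K Dt β ι m ∧ ¬ MinftyGe W K Dt β ι (m + 1) :=
  Iff.rfl

end MinftyGlobal

/-! ## §2. The conjecture (T1) and its two halves -/

/-- `3`-adic TOWER surjectivity `ρ_{E,3^n} : G_ℚ ↠ GL₂(ℤ/3^n)` for all `n ≥ 1` (= `3 ∈ B(E)` of
Kolyvagin; the census bit `towerSurj3` / SURJ9 of the cell; NOT implied by surj mod `3` — Elkies).
A predicate. [cite: GrossLMS1991, §1 (ρ_{E,p} surjective for p ∉ B(E))] -/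
def TowerSurjThree (W : WeierstrassCurve ℚ) : Prop :=
  ∀ n : ℕ, 1 ≤ n → W.HasSurjectiveModNGaloisRep (3 ^ n)

/-- **T1⁺ — DIVISIBILITY half of the refined Kolyvagin conjecture at an additive `3`** ("Jetchev
direction": Jetchev 2008 Thm. 1.4 proves `m_∞ ≥ max_q ord_p c_q` for `p ∤ N`, `ρ̄` onto; Conj. 1.3 is
`m_∞ = ord_p ∏ c_q`): for `W/ℚ` globally minimal elliptic, ADDITIVE at `3` (`9 ∣ N_E`), `ρ_{E,3^∞}` onto,
`K` imaginary quadratic Heegner for `N_E` with `d_K ≠ −3, −4`, `ord_{s=1} L(E/K, s) = 1`, and a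
parametrisation datum with `3 ∤ c(Dt)`: EVERY Kolyvagin class `c_M(n)` is `3^t`-divisible,
`t = ord₃ ∏_q c_q(E)`. FINITELY FALSIFIABLE per pair: one derived class at one Kolyvagin prime less
divisible than `3^t` refutes it (and with the structure theorem refutes BSD₃(E/K)). OPEN; EVIDENCE item of
the cell, not a Literature fact. [cite: Jetchev2008, Conj. 1.3 and Thm. 1.4 (p. 3)]
[cite: WZhang2014, Conj. 3.2 / Thm. 1.1 (refined Kolyvagin, p ∤ N)] -/
@[conjecture] def RKC3Divisibility : Prop :=
  ∀ (W : WeierstrassCurve ℚ) [W.IsElliptic] [W.IsGloballyMinimal],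
    9 ∣ W.conductorNorm ℤ → TowerSurjThree W →
    ∀ (K : Type) [Field K] [NumberField K], IsImaginaryQuadratic K →
      NumberField.discr K ≠ -3 → NumberField.discr K ≠ -4 →
      ∀ [NeZero (W.conductorNorm ℤ)], SatisfiesHeegnerHypothesis (W.conductorNorm ℤ) K →
      analyticRankEK W K = 1 →
      ∀ (Dt : ModularParametrizationData W (W.conductorNorm ℤ)) (β : ℤ) (ι : K →+* ℂ),
        (4 * (W.conductorNorm ℤ : ℤ)) ∣ β ^ 2 - NumberField.discr K → ¬ (3 : ℤ) ∣ Dt.c →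
        MinftyGe W K Dt β ι (padicValNat 3 W.tamagawaProduct)

/-- **T1⁻ — INDIVISIBILITY half of the refined Kolyvagin conjecture at an additive `3`** ("Zhang / BCGS
direction": W. Zhang 2014 Thm. 1.1 and Burungale–Castella–Grossi–Skinner 2026 Thm. 2 prove
`M_∞ = ord_p ∏ c_q` hence `M_∞ ≤ t` for `p ∤ N` good ordinary `p ≥ 5` under hypotheses): same binders;
SOME genuine Kolyvagin class is NOT `3^{t+1}`-divisible. Per pair CERTIFIABLE by exhibiting ONE class
(JLS 2009 instrument: `P_ℓ = Σ iσ^i y_ℓ ∉ 3^{t+1} E(K[ℓ])` via division polynomials over `K[ℓ]`); with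
the structure theorem it gives the LOWER-bound-free inequality `ord₃ #Ш(E/K) ≥ 2(M₀ − t)`, i.e. the
`3`-INDIVISIBILITY of Heegner points beyond Tamagawa. OPEN at `3 ∣ N`; EVIDENCE item of the cell.
[cite: WZhang2014, Thm. 1.1, Thm. 10.2, Remark 18 (pp. 244–246)]
[cite: BurungaleEtAl2026, Thm. 2 (refined Kolyvagin conjecture)] -/
@[conjecture] def RKC3Indivisibility : Prop :=
  ∀ (W : WeierstrassCurve ℚ) [W.IsElliptic] [W.IsGloballyMinimal],
    9 ∣ W.conductorNorm ℤ → TowerSurjThree W →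
    ∀ (K : Type) [Field K] [NumberField K], IsImaginaryQuadratic K →
      NumberField.discr K ≠ -3 → NumberField.discr K ≠ -4 →
      ∀ [NeZero (W.conductorNorm ℤ)], SatisfiesHeegnerHypothesis (W.conductorNorm ℤ) K →
      analyticRankEK W K = 1 →
      ∀ (Dt : ModularParametrizationData W (W.conductorNorm ℤ)) (β : ℤ) (ι : K →+* ℂ),
        (4 * (W.conductorNorm ℤ : ℤ)) ∣ β ^ 2 - NumberField.discr K → ¬ (3 : ℤ) ∣ Dt.c →
        ¬ MinftyGe W K Dt β ι (padicValNat 3 W.tamagawaProduct + 1)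

/-- **T1 — THE REFINED KOLYVAGIN CONJECTURE AT AN ADDITIVE `3` (`RKC₃ᵃᵈᵈ`)**:
`M_∞(E, K, 3) = ord₃ (c(Dt) · ∏_{q∣N} c_q(E))` with `3 ∤ c(Dt)`, i.e. `M_∞ = ord₃ ∏_q c_q(E)`, for every
`E/ℚ` additive at `3` with `ρ_{E,3^∞}` onto and every Heegner `K` (`d_K ≠ −3,−4`) with
`ord_{s=1}L(E/K,s) = 1`. By Kolyvagin's structure theorem (`KolyvaginStructureThreeShape`) EQUIVALENT, pair
by pair, to the `3`-part of BSD for `E/K` in Gross–Zagier form (`X11b.IndexIdentityAt W 3 K P`), hence —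
with the kernel's odd-`p` descent and the rank-`0` `3`-part of the (again additive) twist `E^{d_K}` — to
`BSDp W 3` for the RANK-ONE rows of O5/O6 ∩ X4 ∩ towerSurj(3). The conjunction of the two halves.
OPEN; EVIDENCE / conjecture item of the cell, never a Literature fact; its printed antecedents are the
`p ∤ N` statements cited on the halves. [cite: Jetchev2008, Conj. 1.3] [cite: WZhang2014, Thm. 1.1]
[cite: BurungaleEtAl2026, Thm. 2] [cite: GrossLMS1991, Conj. (1.2)(2), (2.4)] -/
@[conjecture] def RefinedKolyvaginAdditiveThree : Prop :=
  RKC3Divisibility ∧ RKC3Indivisibility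

/-- Unfolding: T1 at a pair is `MinftyEq … t`. [folklore] -/
theorem refinedKolyvaginAdditiveThree_iff :
    RefinedKolyvaginAdditiveThree ↔ RKC3Divisibility ∧ RKC3Indivisibility :=
  Iff.rfl

/-! ## §3. The published structure theorem — the SHAPE of the Literature fact to be typed -/

/-- **SHAPE of Kolyvagin's structure theorem at `p = 3` for analytic rank one over `K`**
(Kolyvagin 1991 [Euler systems, Thm. 1 with `ν = 0`; *On the structure of Shafarevich–Tate groups*,
LNM 1479]; McCallum 1991 Thm. 5.4 (structure of `Ш(E/K)[p^∞]^±` from the classes) + Thm. 5.8; restated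
Zhang 2014 Thm. 10.2 / Remark 18, Jetchev 2008 (1): `#Ш(E/K)[p^∞] = p^{2(M₀ − M_∞)}`): for `W/ℚ`
globally minimal elliptic with `ρ_{E,3^∞}` onto, `K` imaginary quadratic Heegner for `N_E`, `d_K ≠ −3, −4`,
a Heegner point `P ∈ E(K)` of the datum `(Dt, H)` of infinite order, and `M_∞ = m` for the Kolyvagin
system of the SAME datum and orientation `H.β`: `Ш(E/K)` is finite and
`ord₃ #Ш(E/K) + 2m = 2·ord₃ [E(K) : ℤP]` (`E(K)[3] = 0` is automatic: the image of `G_K` contains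
`SL₂(𝔽₃)`, which fixes no non-zero vector — Gross 1991 Lemma 4.3). PRINTED HYPOTHESES: `p` odd,
`p ∉ B(E)` (tower surjectivity), `y_K` non-torsion — NO `p ∤ N` (Gross 1991 Prop. 6.2(1), p. 222, handles
`v ∣ N` incl. `v ∣ p` via Gross–Zagier III.3.1; McCallum §5 (H1)(H2) only) — the `p ∣ N` reading is to be
confirmed line by line by the typer/referee (FLAGGED). A predicate (the named fact will assert it with
`[cite: KolyvaginEulerSystems1990, Thm. 1]`, `[cite: McCallumLMS1991, Thm. 5.4, 5.8]`); nothing asserted here.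
[cite: McCallumLMS1991, Thm. 5.4 (p. 288), Thm. 5.8 (p. 290)] [cite: WZhang2014, Thm. 10.2, Remark 18]
[cite: GrossLMS1991, Prop. 6.2 (p. 222)] -/
def KolyvaginStructureThreeShape : Prop :=
  ∀ (W : WeierstrassCurve ℚ) [W.IsElliptic] [W.IsGloballyMinimal], TowerSurjThree W →
    ∀ (K : Type) [Field K] [NumberField K], IsImaginaryQuadratic K →
      NumberField.discr K ≠ -3 → NumberField.discr K ≠ -4 →
      ∀ [NeZero (W.conductorNorm ℤ)], SatisfiesHeegnerHypothesis (W.conductorNorm ℤ) K →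
      ∀ (Dt : ModularParametrizationData W (W.conductorNorm ℤ))
        (H : HeegnerDatum (W.conductorNorm ℤ) (NumberField.discr K)) (ι : K →+* ℂ)
        (P : (W.baseChange K).toAffine.Point),
        WeierstrassCurve.Affine.Point.map ι.toRatAlgHom P = heegnerPointComplex Dt H →
        ¬ IsOfFinAddOrder P →
        ∀ m : ℕ, MinftyEq W K Dt H.β ι m →
          Finite (W.baseChange K).sha ∧
            padicValNat 3 (W.baseChange K).shaOrder + 2 * m =
              2 * padicValNat 3 (AddSubgroup.zmultiples P).index

/-! ## §4. What T1 buys (bookkeeping shape; the proof is the typers' M-sized item) -/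

/-- **Reduction shape**: the structure theorem and `M_∞ = t` at the pair give the Heegner INDEX
IDENTITY over `K` in the cell's currency — `2·ord₃ ∏_q c_q(E) + ord₃ #Ш(E/K) = 2·ord₃ [E(K):ℤP]`
(= `X11b.IndexIdentityAt W 3 K P`, stated here unfolded to keep this file's imports inside
`Literature/`) — which `X11b.bsdp_of_indexIdentityAt` (`p ≠ 2`, `3 ∤ c(Dt)`, `3 ∤ #𝓞_K^×` automatic for
`d_K ≠ −3`) converts into `BSDp W 3` given the rank-`0` `3`-part of the twist. One line of arithmetic from
`KolyvaginStructureThreeShape`; recorded as a theorem to certify that the binders compose. [folklore] -/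
theorem indexIdentity_of_structure_of_minftyEq
    (hS : KolyvaginStructureThreeShape)
    (W : WeierstrassCurve ℚ) [W.IsElliptic] [W.IsGloballyMinimal] (hρ : TowerSurjThree W)
    (K : Type) [Field K] [NumberField K] (hK : IsImaginaryQuadratic K)
    (h3 : NumberField.discr K ≠ -3) (h4 : NumberField.discr K ≠ -4)
    [NeZero (W.conductorNorm ℤ)] (hHN : SatisfiesHeegnerHypothesis (W.conductorNorm ℤ) K)
    (Dt : ModularParametrizationData W (W.conductorNorm ℤ))
    (H : HeegnerDatum (W.conductorNorm ℤ) (NumberField.discr K)) (ι : K →+* ℂ)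
    (P : (W.baseChange K).toAffine.Point)
    (hP : WeierstrassCurve.Affine.Point.map ι.toRatAlgHom P = heegnerPointComplex Dt H)
    (hnt : ¬ IsOfFinAddOrder P)
    (hT1 : MinftyEq W K Dt H.β ι (padicValNat 3 W.tamagawaProduct)) :
    Finite (W.baseChange K).sha ∧
      2 * padicValNat 3 W.tamagawaProduct + padicValNat 3 (W.baseChange K).shaOrder =
        2 * padicValNat 3 (AddSubgroup.zmultiples P).index := by
  obtain ⟨hfin, h⟩ := hS W hρ K hK h3 h4 hHN Dt H ι P hP hnt _ hT1
  exact ⟨hfin, by omega⟩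

/-- **Lower bound from the INDIVISIBILITY half alone** (the certifiable direction): if the structure
theorem holds in the one-sided form "`M_∞ ≤ m` ⇒ `ord₃ #Ш(E/K) ≥ 2·ord₃[E(K):ℤP] − 2m`" — which is how
McCallum's Thm. 5.4/5.8 is actually proved (each non-`3^{m+1}`-divisible class produces Ш) — then ONE
exhibited class gives `ord₃ #Ш(E/K) + 2(t+1) > 2·ord₃ [E(K):ℤP]`-type bounds. Recorded only as the
statement shape the census certificate would instantiate (per-pair, `t+1` replaced by the exhibited
divisibility defect). A predicate. [cite: McCallumLMS1991, Thm. 5.4 (p. 288)] [cite: JetchevLauterStein2009, Prop. 4.1–4.2] -/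
def OneClassLowerBoundShape : Prop :=
  ∀ (W : WeierstrassCurve ℚ) [W.IsElliptic] [W.IsGloballyMinimal], TowerSurjThree W →
    ∀ (K : Type) [Field K] [NumberField K], IsImaginaryQuadratic K →
      NumberField.discr K ≠ -3 → NumberField.discr K ≠ -4 →
      ∀ [NeZero (W.conductorNorm ℤ)], SatisfiesHeegnerHypothesis (W.conductorNorm ℤ) K →
      ∀ (Dt : ModularParametrizationData W (W.conductorNorm ℤ))
        (H : HeegnerDatum (W.conductorNorm ℤ) (NumberField.discr K)) (ι : K →+* ℂ)
        (P : (W.baseChange K).toAffine.Point),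
        WeierstrassCurve.Affine.Point.map ι.toRatAlgHom P = heegnerPointComplex Dt H →
        ¬ IsOfFinAddOrder P →
        ∀ m : ℕ, ¬ MinftyGe W K Dt H.β ι (m + 1) →
          2 * padicValNat 3 (AddSubgroup.zmultiples P).index ≤
            padicValNat 3 (W.baseChange K).shaOrder + 2 * m

end Summit.BirchSwinnertonDyer.Rank1Residual.AdditiveThree
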